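import Literature.MathematicalPhysics.QuantumFieldTheory.Balaban1983to89.Beta.OneStepKernelFamily
import Literature.MathematicalPhysics.QuantumFieldTheory.Balaban1983to89.Beta.KernelWard
import Literature.MathematicalPhysics.QuantumFieldTheory.Balaban1983to89.Beta.KernelReflection
import Literature.MathematicalPhysics.QuantumFieldTheory.Balaban1983to89.Beta.PlaquetteStencilData

/-!
# Step jet data, I: vertex-slot linearity, the propagator-inserted pair `𝔅 = V ∘ K ∘ V′`, REWEIGHTING of a jet datum
# (DESIGN (D-κ): a colour weight of the bubble carried inside the colourless socket), and the (V-Δ) FIELD-BLOCK first-order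
# stencil of the Wilson action read on the packed fibre (from `Beta/PlaquetteStencilData`); (v1.1) THE STRIPPING CONVENTION — a
# colourless stencil is the coefficient of `ad(t_c)`: the ANTISYMMETRISED field block `wilsonA` (ERRATUM to §4), the adapter `mfNeg`
# VERSIONS: v1 (p187860); v1.1 (this file): §1–§4 byte-identical except the DOCFIX of the §4 bullet below and of the docstrings of
# `wilsonS` / `wilsonS_symm` (ERRATUM, gen 8: `wilsonS` is the SYMMETRIC part of the colourless vertex table — it is NOT the physical
# (V-Δ) stencil, which is the ANTISYMMETRIC part `wilsonA`); NEW §5 (`wilsonA`, `locStencil_wilsonA`, `wilsonA_translate`,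
# `wilsonA_antisymm`, `wilsonS_add_wilsonA_inl_inl`, the block-sign adapter `mfNeg` with `abs_mfNeg`, `mfNeg_mfNeg`, `mfNeg_add`,
# `mfNeg_smul`, `mfNeg_shiftK`, `biLoc_mfNeg`, `locStencil_mfNeg`, `mfNeg_antisymm`, and `locStencil_add` / `locStencil_smul`).

HONEST FRAMING (page 1).  Discharging `FlowStep.BetaPertH` would make Bałaban's ultraviolet stability UNCONDITIONAL — a real
constructive-QFT result; it is NOT the continuum limit and NOT the Clay problem.  This file discharges nothing of `BetaPertH` and
asserts nothing about Bałaban's step jets: it is ELEMENTARY KERNEL CALCULUS over the sockets of `Beta/ExpKernelCalculus`,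
`Beta/OneStepResolventKernel` and `Beta/OneStepKernelFamily` (finite sums, dominated `tsum` exchange from `Beta/KernelWard`, the
triangle inequality) plus ONE finite stencil transcribed from an3's `Beta/PlaquetteStencilData` by name.  No colour weight, no value of
`N`, no table entry of B12 is asserted anywhere: weights are REAL PARAMETERS.

WHY (DESIGN (D-κ) of the β sub-cell's an2 lineage, gen 8).  The typed step kernel of a jet datum is the colourless resolvent Hessian
`TstepOf Lc j J = hessKer K_j V_j J.W`, `hessKer A V W μ ν z = ½·tadpole A (W μ 0 ν z) − ½·bubble A (V μ 0) (V ν z)`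
(`Beta/ExpKernelCalculus` §5), with `K_j := KInvStep Lc j` and the chain-rule vertex `V_j := vertexOfK K_j Lc J.S`.  In the background-
field computation of the one-loop vacuum-polarization coefficient (B12 (1.20)–(1.22): the tensor «of the theory defined by the j-th
fluctuation field integral») the packed resolvent is colour-blind and every first-order background vertex is `ad(t_c) ⊗ (colourless
stencil)`, so the fluctuation-colour trace FACTORISES: the bubble acquires the weight `tr_C(ad t_c · ad t_{c′}) = [c = c′]·κ_b` (a Killing-
form value, NEGATIVE in any normalisation) and the second-order (tadpole) vertices acquire term-wise weights `κ_t`.  A negative bubble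
weight cannot be produced by rescaling a real first-order family (`bubble A (cV) (cV) = c²·bubble A V V`).  It CAN be carried by the
second-order slot: with `𝔅 K V μ y ν y′ := V μ y ∘ (K ∘ V ν y′)` one has `tadpole K (𝔅 K V μ y ν y′) = bubble K (V μ y) (V ν y′)`
(`tadpole_propV`, one Fubini exchange), hence REWEIGHTING `W ↦ W + c • 𝔅 K V` shifts the typed kernel by `(c/2)·bubble`
(`hessKer_reweight`, `TstepOf_reweight`): `c := 1 − κ_b` turns `−½·bubble` into `−½κ_b·bubble` while `J.S` stays the GENUINE stencil
(so `LocStencil`, `vertexOfK` and the Ward bricks keep their meaning).  The weights enter this file only as the real parameter `c`.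

CONTENT.
* §1 VERTEX-SLOT LINEARITY: `comp_add_right`, `tr_add`, `biLoc_smul`, `biLoc_weaken`, `decays_weaken` (the scalar halves
  `comp_smul_right`, `tr_smul` are `Beta/KernelReflection`'s, by name), and
  `tadpole_add_smul : tadpole A (W + c • B) = tadpole A W + c · tadpole A B` for a decaying `A` and bi-localised `W`, `B`.
* §2 THE PROPAGATOR-INSERTED PAIR `propV K V μ y ν y′ := comp (V μ y) (comp K (V ν y′))`: `vertexFamily₂_propV` (it is a second-order
  vertex family, explicit constant, rate `δ/2`), `comp_propV` / `tadpole_propV` (`tadpole K 𝔅 = bubble K V V′`, via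
  `KernelWard.comp_assoc_dbb`), `propV_translate` (block covariance from that of `K` and `V`).
* §3 REWEIGHTING: `JetData.reweight J c K hδb hB` := `⟨J.S, J.W + c • propV K (vertexOfK K N J.S), …⟩` with its localisation data;
  `hessKer_reweight` (the (D-κ) identity for any decaying `K`), `vertexFamily₂_propV_vertexOfK` (the rates exist for any decaying `K`),
  `reweightStep Lc j c J` (the step-`j` instance, `K := KInvStep Lc j`) and
  `TstepOf_reweightStep : TstepOf Lc j (reweightStep Lc j c J) μ ν z = TstepOf Lc j J μ ν z + c/2 · bubble (KInvStep Lc j) (V_j μ 0) (V_j ν z)`.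
* §4 THE (V-Δ) FIELD-BLOCK STENCIL `wilsonS d κ′ u : MKer (d+1) (Fib d)`: on the field block `(inl α, inl β)` the SYMMETRISED entries
  of an3's colour-generic one-bond Wilson vertex `PlaquetteStencil.wilsonVertex₁ e u κ′ A` at the colourless instance `C := Unit`,
  `A := 1`, `e := unitVec`, lattice `Λ := ℤ^{d+1}`; zero on the multiplier blocks.  ERRATUM (v1.1): v1 symmetrised «because a vertex
  matrix `M` of the symmetric Hessian operator determines only `M + Mᵀ`» — true of the COLOURED matrix `M(ad Y) = k ⊗ ad Y`, but
  `ad Y` is antisymmetric (`PlaquetteVertex.adM_antisymm`), so `sym(k ⊗ ad Y) = antisym(k) ⊗ ad Y`: the physical colourless table is the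
  ANTISYMMETRIC part of `k = wEntry` (§5's `wilsonA`) and `wilsonS` (the symmetric part) cancels in an3's quadratic form
  `PlaquetteStencil.actionJet21_eq_wilsonVertex₁`; `wilsonS` and its (true) lemmas are kept as landed.  `abs_wEntry_le` (uniform entry
  bound `wBound d`, a finite sum of absolute table entries — no table value is used), `l1_isOffset_le` (the offset alphabet lies in
  the `ℓ¹`-ball of radius 2), `locStencil_wilsonS : LocStencil (wilsonS d) (wBound d · e^{4δ}) δ` for every `δ ≥ 0` (finite range ⇒
  any rate), `wilsonS_translate : wilsonS d κ′ (u + v) = shiftK (−v) (wilsonS d κ′ u)` (the covariance `vertexOfK_translate` asks).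
  SCOPE OF §4 (recorded, not asserted): in the located picture of `Beta/OneStepKernelFamily` (`KInvStep Lc j` lives on the step-`j`
  lattice) Bałaban's first-order stencil at step `j` is the third jet of the `j`-step EFFECTIVE form, which is `j`-dependent and for
  `j ≥ 1` exponentially (not finitely) localised; `wilsonS` is its `j = 0` field block (`E₀ = ` the Wilson action) and the fine-lattice
  building block of its leading term at every `j` (read `wilsonA` for `wilsonS` in this sentence, v1.1).  The field–multiplier blocks
  (second jets of one averaging) and the second-order family are NOT in this file.
* §5 (v1.1) THE STRIPPING CONVENTION of the colourless `hessKer` model (binding for every consumer of `JetData` on this route): the TRUE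
  first-order background vertex in colour direction `c` is `S_true(r, s) = S(r, s) · (ad t_c)_{(colour of r),(colour of s)}` UNIFORMLY over
  the packed fibre (rows/columns `r, s` = field or multiplier legs), so that the fluctuation-colour trace factorises
  (`bubble (A ⊗ 1) (S ⊗ ad t_c) (S′ ⊗ ad t_{c′}) = bubble A S S′ · tr_C(ad t_c ad t_{c′})`); since `S_true` is symmetric and `ad t_c`
  antisymmetric, THE COLOURLESS STENCIL `S` IS ANTISYMMETRIC: field block = `wilsonA` (`locStencil_wilsonA`, `wilsonA_translate`,
  `wilsonA_antisymm`, `wilsonS_add_wilsonA_inl_inl`), field–multiplier blocks `(inl, inr) = m`, `(inr, inl) = −mᵀ` — the adapter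
  `mfNeg` (negate the `(inr, inl)` block: `abs_mfNeg`, `mfNeg_mfNeg`, `mfNeg_add`, `mfNeg_smul`, `mfNeg_shiftK`, `biLoc_mfNeg`,
  `locStencil_mfNeg`, `mfNeg_antisymm`) converts a symmetrically placed field–multiplier family (the shape of an1's
  `AveragingHessianKernels.packVH` / `vhS`) into this convention; `locStencil_add`, `locStencil_smul` assemble weighted blocks.  A
  symmetric placement of the field–multiplier blocks next to an antisymmetric field block would flip the sign of the field × field–
  multiplier cross terms of `bubble` (they would cancel instead of doubling); no weight can repair that, hence the convention.

All declarations are [folklore]: definitions, or proved here from the imports; zero cited facts; the B12 tags above are LOCATORS only.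
-/

open Finset
open scoped BigOperators
open Literature.MathematicalPhysics.QuantumFieldTheory.Balaban1983to89
open Literature.MathematicalPhysics.QuantumFieldTheory.Balaban1983to89.Beta
open B12Sec2to5 (l1 l1_nonneg)
open ExpKernelCalculus (Decays BiLoc comp tr bubble tadpole VertexFamily VertexFamily₂ hessKer shiftK comp_shiftK Zl Zl_nonneg
  biLoc_comp_decays biLoc_comp_biLoc summable_trTerm)
open KernelReflection (comp_smul_right tr_smul)
open KernelWard (Bdd bdd_of_decays slices_bdd_biLoc biLoc_add comp_assoc_dbb)
open OneStepResolventKernel (Fib LocStencil JetData bound_mono)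
open OneStepKernelFamily (KInvStep decays_KInvStep vertexOfK vertexFamily_vertexOfK TstepOf l1_neg_eq)
open B6BondElimination (unitVec unitVec_apply)
open PlaquetteStencil (wilsonVertex₁)
open PlaquetteStencilData (WilsonIdx wm IsOffset wilsonVertex₁_apply wilsonVertex₁_translate wilsonVertex₁_apply_ne_zero)

noncomputable section

namespace Literature.MathematicalPhysics.QuantumFieldTheory.Balaban1983to89.Beta.StepJetData

/-! ## §1 Vertex-slot linearity of composition, trace and tadpole -/

section Linear

variable {D : ℕ} {F : Type*} [Fintype F]

omit [Fintype F] in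
/-- A `BiLoc` bound weakens to a larger constant and a smaller rate (no sign hypothesis needed: the fibre index in hand gives
`0 ≤ C`). [folklore] -/
theorem biLoc_weaken {K : ExpKernelCalculus.MKer D F} {p q : Fin D → ℤ} {C C' δ δ' : ℝ} (h : BiLoc K p q C δ) (hC : C ≤ C')
    (hδ : δ' ≤ δ) : BiLoc K p q C' δ' :=
  fun x y a b => bound_mono (h x y a b) (h.nonneg a) hC hδ (add_nonneg (l1_nonneg _) (l1_nonneg _))

omit [Fintype F] in
/-- A `Decays` bound weakens to a larger constant and a smaller rate. [folklore] -/
theorem decays_weaken {A : ExpKernelCalculus.MKer D F} {C C' δ δ' : ℝ} (h : Decays A C δ) (hC : C ≤ C') (hδ : δ' ≤ δ) :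
    Decays A C' δ' :=
  fun x y a b => bound_mono (h x y a b) (h.nonneg a) hC hδ (l1_nonneg _)

omit [Fintype F] in
/-- A scalar multiple of a bi-localised kernel is bi-localised with constant `|c|·C`. [folklore] -/
theorem biLoc_smul {K : ExpKernelCalculus.MKer D F} {p q : Fin D → ℤ} {C δ : ℝ} (h : BiLoc K p q C δ) (c : ℝ) :
    BiLoc (c • K) p q (|c| * C) δ := by
  intro x y a b
  show |c * K x y a b| ≤ |c| * C * Real.exp (-δ * (l1 (x - p) + l1 (y - q)))
  rw [abs_mul, mul_assoc]
  exact mul_le_mul_of_nonneg_left (h x y a b) (abs_nonneg c)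

/-- `A ∘ (K + L) = A ∘ K + A ∘ L` (given slice summability). [folklore] -/
theorem comp_add_right {A K L : ExpKernelCalculus.MKer D F}
    (hK : ∀ x z a b, Summable fun y : Fin D → ℤ => ∑ f, A x y a f * K y z f b)
    (hL : ∀ x z a b, Summable fun y : Fin D → ℤ => ∑ f, A x y a f * L y z f b) :
    comp A (K + L) = comp A K + comp A L := by
  funext x z a b
  show (∑' y, ∑ f, A x y a f * (K + L) y z f b) = (∑' y, ∑ f, A x y a f * K y z f b) + ∑' y, ∑ f, A x y a f * L y z f b
  rw [← (hK x z a b).tsum_add (hL x z a b)]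
  refine tsum_congr fun y => ?_
  rw [← Finset.sum_add_distrib]
  refine Finset.sum_congr rfl fun f _ => ?_
  simp only [Pi.add_apply]
  ring

/-- `tr (K + L) = tr K + tr L` (given trace summability). [folklore] -/
theorem tr_add {K L : ExpKernelCalculus.MKer D F} (hK : Summable fun x : Fin D → ℤ => ∑ a, K x x a a)
    (hL : Summable fun x : Fin D → ℤ => ∑ a, L x x a a) : tr (K + L) = tr K + tr L := by
  show (∑' x, ∑ a, (K + L) x x a a) = (∑' x, ∑ a, K x x a a) + ∑' x, ∑ a, L x x a a
  rw [← hK.tsum_add hL]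
  refine tsum_congr fun x => ?_
  rw [← Finset.sum_add_distrib]
  refine Finset.sum_congr rfl fun a _ => ?_
  simp only [Pi.add_apply]

/-- **VERTEX-SLOT LINEARITY OF THE TADPOLE**: `tadpole A (W + c • B) = tadpole A W + c · tadpole A B` for a decaying `A` and
bi-localised `W`, `B` (common rate `δ > 0`). [folklore] -/
theorem tadpole_add_smul {A W B : ExpKernelCalculus.MKer D F} {C Cw Cb δ : ℝ} {p q p' q' : Fin D → ℤ} (hA : Decays A C δ)
    (hW : BiLoc W p q Cw δ) (hB : BiLoc B p' q' Cb δ) (hδ : 0 < δ) (c : ℝ) :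
    tadpole A (W + c • B) = tadpole A W + c * tadpole A B := by
  have hδ2 : 0 < δ / 2 := by linarith
  have hAb : Bdd A C := bdd_of_decays hA hδ.le
  have hsW : ∀ x z a b, Summable fun y : Fin D → ℤ => ∑ f, A x y a f * W y z f b := slices_bdd_biLoc hAb hW hδ
  have hsB : ∀ x z a b, Summable fun y : Fin D → ℤ => ∑ f, A x y a f * (c • B) y z f b :=
    slices_bdd_biLoc hAb (biLoc_smul hB c) hδ
  have h1 := biLoc_comp_decays hA hW hδ2.le (by linarith : δ / 2 < δ)
  have h2 := biLoc_comp_decays hA hB hδ2.le (by linarith : δ / 2 < δ)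
  unfold tadpole
  rw [comp_add_right hsW hsB, comp_smul_right, tr_add (summable_trTerm h1 hδ2) (summable_trTerm (biLoc_smul h2 c) hδ2), tr_smul]

end Linear

/-! ## §2 The propagator-inserted pair `𝔅 = V ∘ K ∘ V′` -/

section PropV

variable {D : ℕ} {F : Type*} [Fintype F]

/-- **THE PROPAGATOR-INSERTED PAIR** `𝔅`: `propV K V μ y ν y′ := V μ y ∘ (K ∘ V ν y′)` — two first-order vertices joined by one
propagator, read as a SECOND-ORDER vertex kernel (its tadpole is the bubble, `tadpole_propV`).  A definition asserting nothing. [folklore] -/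
def propV (K : ExpKernelCalculus.MKer D F) (V : Fin D → (Fin D → ℤ) → ExpKernelCalculus.MKer D F) (μ : Fin D) (y : Fin D → ℤ)
    (ν : Fin D) (y' : Fin D → ℤ) : ExpKernelCalculus.MKer D F :=
  comp (V μ y) (comp K (V ν y'))

/-- The inner composite `K ∘ V ν y′` is bi-localised at the coarse point of the second bond (rate `δ/2`). [folklore] -/
theorem biLoc_comp_vertex {K : ExpKernelCalculus.MKer D F} {V : Fin D → (Fin D → ℤ) → ExpKernelCalculus.MKer D F} {N : ℕ}
    {C Cv δ : ℝ} (hA : Decays K C δ) (hV : VertexFamily V N Cv δ) (hδ : 0 < δ) (ν : Fin D) (y' : Fin D → ℤ) :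
    BiLoc (comp K (V ν y')) ((N : ℤ) • y') ((N : ℤ) • y') ((Fintype.card F : ℝ) * (C * Cv) * Zl D (δ - δ / 2)) (δ / 2) :=
  biLoc_comp_decays hA (hV ν y') (by linarith) (by linarith)

/-- **`𝔅` IS A SECOND-ORDER VERTEX FAMILY** (explicit constant, rate `δ/2`). [folklore] -/
theorem vertexFamily₂_propV {K : ExpKernelCalculus.MKer D F} {V : Fin D → (Fin D → ℤ) → ExpKernelCalculus.MKer D F} {N : ℕ}
    {C Cv δ : ℝ} (hA : Decays K C δ) (hV : VertexFamily V N Cv δ) (hδ : 0 < δ) :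
    VertexFamily₂ (propV K V) N
      ((Fintype.card F : ℝ) * (Cv * ((Fintype.card F : ℝ) * (C * Cv) * Zl D (δ - δ / 2))) * Zl D (δ / 2 / 2)) (δ / 2) := by
  intro μ y ν y'
  rcases isEmpty_or_nonempty F with hF | ⟨⟨a₀⟩⟩
  · intro x z a b
    exact isEmptyElim a
  have hC : 0 ≤ C := hA.nonneg a₀
  have hCv : 0 ≤ Cv := (hV μ y).nonneg a₀
  have h1 := biLoc_comp_vertex hA hV hδ ν y'
  have hVm : BiLoc (V μ y) ((N : ℤ) • y) ((N : ℤ) • y) Cv (δ / 2) := biLoc_weaken (hV μ y) le_rfl (by linarith)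
  have h2 := biLoc_comp_biLoc hVm h1 (half_pos hδ)
  refine biLoc_weaken h2 ?_ le_rfl
  have hexp : Real.exp (-(δ / 2 / 2) * l1 ((N : ℤ) • y - (N : ℤ) • y')) ≤ 1 :=
    Real.exp_le_one_iff.mpr (by nlinarith [l1_nonneg ((N : ℤ) • y - (N : ℤ) • y')])
  have hZ1 : 0 ≤ Zl D (δ - δ / 2) := Zl_nonneg (by linarith)
  have hZ2 : 0 ≤ Zl D (δ / 2 / 2) := Zl_nonneg (by positivity)
  have hnn : 0 ≤ (Fintype.card F : ℝ) * (Cv * ((Fintype.card F : ℝ) * (C * Cv) * Zl D (δ - δ / 2))) * Zl D (δ / 2 / 2) := by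
    positivity
  calc (Fintype.card F : ℝ) * (Cv * ((Fintype.card F : ℝ) * (C * Cv) * Zl D (δ - δ / 2))) * Zl D (δ / 2 / 2) *
          Real.exp (-(δ / 2 / 2) * l1 ((N : ℤ) • y - (N : ℤ) • y'))
        ≤ (Fintype.card F : ℝ) * (Cv * ((Fintype.card F : ℝ) * (C * Cv) * Zl D (δ - δ / 2))) * Zl D (δ / 2 / 2) * 1 :=
          mul_le_mul_of_nonneg_left hexp hnn
    _ = _ := mul_one _

/-- **ONE FUBINI EXCHANGE**: `K ∘ (V μ y ∘ (K ∘ V ν y′)) = (K ∘ V μ y) ∘ (K ∘ V ν y′)` (`KernelWard.comp_assoc_dbb`). [folklore] -/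
theorem comp_propV {K : ExpKernelCalculus.MKer D F} {V : Fin D → (Fin D → ℤ) → ExpKernelCalculus.MKer D F} {N : ℕ}
    {C Cv δ : ℝ} (hA : Decays K C δ) (hV : VertexFamily V N Cv δ) (hδ : 0 < δ) (μ : Fin D) (y : Fin D → ℤ) (ν : Fin D)
    (y' : Fin D → ℤ) : comp K (propV K V μ y ν y') = comp (comp K (V μ y)) (comp K (V ν y')) := by
  have h1 := biLoc_comp_vertex hA hV hδ ν y'
  have hAm : Decays K C (δ / 2) := decays_weaken hA le_rfl (by linarith)
  have hVm : BiLoc (V μ y) ((N : ℤ) • y) ((N : ℤ) • y) Cv (δ / 2) := biLoc_weaken (hV μ y) le_rfl (by linarith)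
  exact comp_assoc_dbb hAm hVm h1 (half_pos hδ)

/-- **THE TADPOLE OF `𝔅` IS THE BUBBLE**: `tadpole K (𝔅 K V μ y ν y′) = bubble K (V μ y) (V ν y′)`. [folklore] -/
theorem tadpole_propV {K : ExpKernelCalculus.MKer D F} {V : Fin D → (Fin D → ℤ) → ExpKernelCalculus.MKer D F} {N : ℕ}
    {C Cv δ : ℝ} (hA : Decays K C δ) (hV : VertexFamily V N Cv δ) (hδ : 0 < δ) (μ : Fin D) (y : Fin D → ℤ) (ν : Fin D)
    (y' : Fin D → ℤ) : tadpole K (propV K V μ y ν y') = bubble K (V μ y) (V ν y') := by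
  unfold tadpole bubble
  rw [comp_propV hA hV hδ]

/-- **BLOCK COVARIANCE OF `𝔅`** from that of `K` (`covA`) and `V` (`covV`). [folklore] -/
theorem propV_translate {K : ExpKernelCalculus.MKer D F} {V : Fin D → (Fin D → ℤ) → ExpKernelCalculus.MKer D F}
    {N : ℕ} (hKs : ∀ t : Fin D → ℤ, shiftK (-((N : ℤ) • t)) K = K)
    (hVs : ∀ (μ : Fin D) (y t : Fin D → ℤ), V μ (y + t) = shiftK (-((N : ℤ) • t)) (V μ y)) (μ : Fin D) (y : Fin D → ℤ)
    (ν : Fin D) (y' t : Fin D → ℤ) : propV K V μ (y + t) ν (y' + t) = shiftK (-((N : ℤ) • t)) (propV K V μ y ν y') := by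
  unfold propV
  rw [hVs μ y t, hVs ν y' t, ← comp_shiftK, ← comp_shiftK, hKs t]

end PropV

/-! ## §3 Reweighting a jet datum (DESIGN (D-κ)) -/

section Reweight

variable {d N : ℕ}

/-- **REWEIGHTING A JET DATUM** against a packed kernel `K` with the real weight `c`: the stencil family is KEPT, the second-order
family becomes `W + c • 𝔅 K (vertexOfK K N S)`; the localisation data are re-derived (rate `min J.δ δb`).  A definition asserting
nothing; in the (D-κ) design `c = 1 − κ_b` with `κ_b` the bubble's colour weight (a real parameter here). [folklore] -/
def _root_.Literature.MathematicalPhysics.QuantumFieldTheory.Balaban1983to89.Beta.OneStepResolventKernel.JetData.reweight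
    (J : JetData d N) (c : ℝ) (K : ExpKernelCalculus.MKer (d + 1) (Fib d)) {Cb δb : ℝ} (hδb : 0 < δb)
    (hB : VertexFamily₂ (propV K (vertexOfK K N J.S)) N Cb δb) : JetData d N where
  S := J.S
  W := fun μ y ν y' => J.W μ y ν y' + c • propV K (vertexOfK K N J.S) μ y ν y'
  Cs := J.Cs
  Cw := J.Cw + |c| * Cb
  δ := min J.δ δb
  δ_pos := lt_min J.δ_pos hδb
  loc := fun κ' u => biLoc_weaken (J.loc κ' u) le_rfl (min_le_left _ _)
  loc₂ := fun μ y ν y' =>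
    biLoc_add (biLoc_weaken (J.loc₂ μ y ν y') le_rfl (min_le_left _ _))
      (biLoc_weaken (biLoc_smul (hB μ y ν y') c) le_rfl (min_le_right _ _))

/-- The stencil family of a reweighted datum is the original one. [folklore] -/
@[simp] theorem reweight_S (J : JetData d N) (c : ℝ) (K : ExpKernelCalculus.MKer (d + 1) (Fib d)) {Cb δb : ℝ} (hδb : 0 < δb)
    (hB : VertexFamily₂ (propV K (vertexOfK K N J.S)) N Cb δb) : (J.reweight c K hδb hB).S = J.S := rfl

/-- The second-order family of a reweighted datum. [folklore] -/
theorem reweight_W (J : JetData d N) (c : ℝ) (K : ExpKernelCalculus.MKer (d + 1) (Fib d)) {Cb δb : ℝ} (hδb : 0 < δb)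
    (hB : VertexFamily₂ (propV K (vertexOfK K N J.S)) N Cb δb) (μ : Fin (d + 1)) (y : Fin (d + 1) → ℤ) (ν : Fin (d + 1))
    (y' : Fin (d + 1) → ℤ) :
    (J.reweight c K hδb hB).W μ y ν y' = J.W μ y ν y' + c • propV K (vertexOfK K N J.S) μ y ν y' := rfl

/-- **THE RATES EXIST**: for any decaying packed kernel `K` and any jet datum, `𝔅 K (vertexOfK K N J.S)` is a second-order vertex
family. [folklore] -/
theorem vertexFamily₂_propV_vertexOfK {K : ExpKernelCalculus.MKer (d + 1) (Fib d)}
    (hK : ∃ δ C : ℝ, 0 < δ ∧ 0 ≤ C ∧ Decays K C δ) (J : JetData d N) :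
    ∃ Cb δb : ℝ, 0 < δb ∧ VertexFamily₂ (propV K (vertexOfK K N J.S)) N Cb δb := by
  obtain ⟨δK, C, hδK, hC, h⟩ := hK
  have h0 : 0 < min J.δ δK := lt_min J.δ_pos hδK
  have hS' : LocStencil J.S J.Cs (min J.δ δK) := fun κ' u => biLoc_weaken (J.loc κ' u) le_rfl (min_le_left _ _)
  have hV := vertexFamily_vertexOfK (N := N) h hC hS' h0 (min_le_right _ _)
  have hKm : Decays K C (min J.δ δK / 2) := decays_weaken h le_rfl (by linarith [min_le_right J.δ δK])
  exact ⟨_, _, half_pos (half_pos h0), vertexFamily₂_propV hKm hV (half_pos h0)⟩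

/-- **THE (D-κ) IDENTITY** for any decaying packed kernel `K`: reweighting by `c` shifts the resolvent Hessian kernel of the datum by
`(c/2)·bubble K (V μ 0) (V ν z)`, `V = vertexOfK K N J.S`. [folklore] -/
theorem hessKer_reweight (J : JetData d N) (c : ℝ) {K : ExpKernelCalculus.MKer (d + 1) (Fib d)}
    (hK : ∃ δ C : ℝ, 0 < δ ∧ 0 ≤ C ∧ Decays K C δ) {Cb δb : ℝ} (hδb : 0 < δb)
    (hB : VertexFamily₂ (propV K (vertexOfK K N J.S)) N Cb δb) (μ ν : Fin (d + 1)) (z : Fin (d + 1) → ℤ) :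
    hessKer K (vertexOfK K N J.S) (J.reweight c K hδb hB).W μ ν z =
      hessKer K (vertexOfK K N J.S) J.W μ ν z + c / 2 * bubble K (vertexOfK K N J.S μ 0) (vertexOfK K N J.S ν z) := by
  obtain ⟨δK, C, hδK, hC, h⟩ := hK
  have h0 : 0 < min J.δ δK := lt_min J.δ_pos hδK
  have hS' : LocStencil J.S J.Cs (min J.δ δK) := fun κ' u => biLoc_weaken (J.loc κ' u) le_rfl (min_le_left _ _)
  have hV := vertexFamily_vertexOfK (N := N) h hC hS' h0 (min_le_right _ _)
  -- a common rate for `K`, `V`, `J.W` and `𝔅`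
  set δ₀ : ℝ := min (min J.δ δK / 2) δb with hδ₀
  have hδ₀pos : 0 < δ₀ := lt_min (half_pos h0) hδb
  have hδ₀1 : δ₀ ≤ min J.δ δK / 2 := min_le_left _ _
  have hδ₀2 : δ₀ ≤ δb := min_le_right _ _
  have hK0 : Decays K C δ₀ := decays_weaken h le_rfl (by linarith [min_le_right J.δ δK])
  have hV0 : VertexFamily (vertexOfK K N J.S) N _ δ₀ := fun μ' y => biLoc_weaken (hV μ' y) le_rfl hδ₀1
  have hW0 : BiLoc (J.W μ 0 ν z) ((N : ℤ) • (0 : Fin (d + 1) → ℤ)) ((N : ℤ) • z) J.Cw δ₀ :=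
    biLoc_weaken (J.loc₂ μ 0 ν z) le_rfl (by linarith [min_le_left J.δ δK])
  have hB0 : BiLoc (propV K (vertexOfK K N J.S) μ 0 ν z) ((N : ℤ) • (0 : Fin (d + 1) → ℤ)) ((N : ℤ) • z) Cb δ₀ :=
    biLoc_weaken (hB μ 0 ν z) le_rfl hδ₀2
  simp only [hessKer, reweight_W]
  rw [tadpole_add_smul hK0 hW0 hB0 hδ₀pos c, tadpole_propV hK0 hV0 hδ₀pos]
  ring

variable {Lc : ℕ} [NeZero Lc]

/-- **THE (D-κ) IDENTITY FOR THE TYPED STEP KERNEL**: `TstepOf Lc j (J.reweight c K_j …) = TstepOf Lc j J + (c/2)·bubble K_j (V_j μ 0) (V_j ν z)`,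
`K_j = KInvStep Lc j`, `V_j = vertexOfK K_j Lc J.S`. [folklore] -/
theorem TstepOf_reweight (j : ℕ) (J : JetData d Lc) (c : ℝ) {Cb δb : ℝ} (hδb : 0 < δb)
    (hB : VertexFamily₂ (propV (KInvStep (d := d) Lc j) (vertexOfK (KInvStep (d := d) Lc j) Lc J.S)) Lc Cb δb)
    (μ ν : Fin (d + 1)) (z : Fin (d + 1) → ℤ) :
    TstepOf Lc j (J.reweight c (KInvStep (d := d) Lc j) hδb hB) μ ν z =
      TstepOf Lc j J μ ν z + c / 2 * bubble (KInvStep (d := d) Lc j) (vertexOfK (KInvStep (d := d) Lc j) Lc J.S μ 0)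
        (vertexOfK (KInvStep (d := d) Lc j) Lc J.S ν z) := by
  unfold TstepOf
  exact hessKer_reweight J c (decays_KInvStep (d := d) (Lc := Lc) j) hδb hB μ ν z

/-- **THE STEP-`j` REWEIGHTED DATUM** `reweightStep Lc j c J` := `J.reweight c (KInvStep Lc j)` with the rates of
`vertexFamily₂_propV_vertexOfK` (chosen by `Classical.choice`; only their existence is used).  A definition asserting nothing. [folklore] -/
def reweightStep (Lc : ℕ) [NeZero Lc] (j : ℕ) (c : ℝ) (J : JetData d Lc) : JetData d Lc :=
  J.reweight c (KInvStep (d := d) Lc j)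
    (vertexFamily₂_propV_vertexOfK (N := Lc) (decays_KInvStep (d := d) (Lc := Lc) j) J).choose_spec.choose_spec.1
    (vertexFamily₂_propV_vertexOfK (N := Lc) (decays_KInvStep (d := d) (Lc := Lc) j) J).choose_spec.choose_spec.2

/-- The stencil family of the step-reweighted datum is the original one. [folklore] -/
@[simp] theorem reweightStep_S (j : ℕ) (c : ℝ) (J : JetData d Lc) : (reweightStep Lc j c J).S = J.S := rfl

/-- **`TstepOf` OF THE STEP-REWEIGHTED DATUM**: `TstepOf Lc j (reweightStep Lc j c J) μ ν z = TstepOf Lc j J μ ν z + (c/2)·bubble K_j (V_j μ 0) (V_j ν z)`.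
With `hessKer = ½·tadpole − ½·bubble` this reads `½·tadpole K_j (J.W μ 0 ν z) − ((1 − c)/2)·bubble K_j (V_j μ 0) (V_j ν z)`: the
weight `1 − c` multiplies the bubble. [folklore] -/
theorem TstepOf_reweightStep (j : ℕ) (c : ℝ) (J : JetData d Lc) (μ ν : Fin (d + 1)) (z : Fin (d + 1) → ℤ) :
    TstepOf Lc j (reweightStep Lc j c J) μ ν z =
      TstepOf Lc j J μ ν z + c / 2 * bubble (KInvStep (d := d) Lc j) (vertexOfK (KInvStep (d := d) Lc j) Lc J.S μ 0)
        (vertexOfK (KInvStep (d := d) Lc j) Lc J.S ν z) :=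
  TstepOf_reweight j J c _ _ μ ν z

/-- The same identity in the `½·tadpole − ((1−c)/2)·bubble` form. [folklore] -/
theorem TstepOf_reweightStep_eq (j : ℕ) (c : ℝ) (J : JetData d Lc) (μ ν : Fin (d + 1)) (z : Fin (d + 1) → ℤ) :
    TstepOf Lc j (reweightStep Lc j c J) μ ν z =
      (1 / 2) * tadpole (KInvStep (d := d) Lc j) (J.W μ 0 ν z) -
        (1 - c) / 2 * bubble (KInvStep (d := d) Lc j) (vertexOfK (KInvStep (d := d) Lc j) Lc J.S μ 0)
          (vertexOfK (KInvStep (d := d) Lc j) Lc J.S ν z) := by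
  rw [TstepOf_reweightStep]
  simp only [TstepOf, hessKer]
  ring

end Reweight

/-! ## §4 The (V-Δ) field-block stencil of the Wilson action on the packed fibre -/

section Wilson

variable {d : ℕ}

/-- An ENTRY of an3's colour-generic one-bond Wilson vertex at the colourless instance (`C := Unit`, `A := 1`, `e := unitVec`,
`Λ := ℤ^{d+1}`): row `(x, α)`, column `(z, β)`, background bond `(κ′, u)`.  A definition asserting nothing. [folklore] -/
def wEntry (d : ℕ) (κ' : Fin (d + 1)) (u x z : Fin (d + 1) → ℤ) (α β : Fin (d + 1)) : ℝ :=
  wilsonVertex₁ (C := Unit) unitVec u κ' (1 : Matrix Unit Unit ℝ) (x, ((), α)) (z, ((), β))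

/-- **THE SYMMETRISED FIELD-BLOCK TABLE** `wilsonS d κ′ u`: on the field block the SYMMETRISED Wilson vertex entries
`½·(w(x,α; z,β) + w(z,β; x,α))`, zero on every block touching a multiplier leg.  ERRATUM (v1.1): this is NOT the physical (V-Δ)
stencil — against the antisymmetric colour insertion `ad Y` (`PlaquetteVertex.adM_antisymm`) the symmetric part of the colourless table
cancels in an3's quadratic form `PlaquetteStencil.actionJet21_eq_wilsonVertex₁`; the physical colourless field block is the
ANTISYMMETRISED table `wilsonA` of §5.  Kept as landed (a definition asserting nothing; its lemmas below are true as stated). [folklore] -/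
def wilsonS (d : ℕ) (κ' : Fin (d + 1)) (u : Fin (d + 1) → ℤ) : ExpKernelCalculus.MKer (d + 1) (Fib d) :=
  fun x z a b =>
    match a, b with
    | Sum.inl α, Sum.inl β => (1 / 2) * (wEntry d κ' u x z α β + wEntry d κ' u z x β α)
    | Sum.inl _, Sum.inr _ => 0
    | Sum.inr _, Sum.inl _ => 0
    | Sum.inr _, Sum.inr _ => 0

/-- A UNIFORM BOUND on the colourless Wilson vertex entries: the finite sum of the absolute values of all block-table entries over
all directions and fibre indices (no table value is used). [folklore] -/
def wBound (d : ℕ) : ℝ :=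
  ∑ γ : Fin (d + 1), ∑ a : Unit × Fin (d + 1), ∑ b : Unit × Fin (d + 1), ∑ i : WilsonIdx (Fin (d + 1)),
    |wm γ (1 : Matrix Unit Unit ℝ) i a b|

/-- `0 ≤ wBound d`. [folklore] -/
theorem wBound_nonneg (d : ℕ) : 0 ≤ wBound d :=
  Finset.sum_nonneg fun _ _ => Finset.sum_nonneg fun _ _ => Finset.sum_nonneg fun _ _ =>
    Finset.sum_nonneg fun _ _ => abs_nonneg _

/-- Every entry is bounded by `wBound d`. [folklore] -/
theorem abs_wEntry_le (κ' : Fin (d + 1)) (u x z : Fin (d + 1) → ℤ) (α β : Fin (d + 1)) : |wEntry d κ' u x z α β| ≤ wBound d := by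
  unfold wEntry
  rw [wilsonVertex₁_apply]
  refine (Finset.abs_sum_le_sum_abs _ _).trans ?_
  refine (Finset.sum_le_sum (g := fun i : WilsonIdx (Fin (d + 1)) =>
    |wm κ' (1 : Matrix Unit Unit ℝ) i ((), α) ((), β)|) fun i _ => ?_).trans ?_
  · dsimp only
    split_ifs
    · exact le_rfl
    · rw [abs_zero]; exact abs_nonneg _
  have hb : (∑ i : WilsonIdx (Fin (d + 1)), |wm κ' (1 : Matrix Unit Unit ℝ) i ((), α) ((), β)|) ≤
      ∑ b : Unit × Fin (d + 1), ∑ i : WilsonIdx (Fin (d + 1)), |wm κ' (1 : Matrix Unit Unit ℝ) i ((), α) b| :=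
    Finset.single_le_sum (f := fun b : Unit × Fin (d + 1) => ∑ i : WilsonIdx (Fin (d + 1)),
      |wm κ' (1 : Matrix Unit Unit ℝ) i ((), α) b|) (fun _ _ => Finset.sum_nonneg fun _ _ => abs_nonneg _)
      (Finset.mem_univ ((), β))
  have ha : (∑ b : Unit × Fin (d + 1), ∑ i : WilsonIdx (Fin (d + 1)), |wm κ' (1 : Matrix Unit Unit ℝ) i ((), α) b|) ≤
      ∑ a : Unit × Fin (d + 1), ∑ b : Unit × Fin (d + 1), ∑ i : WilsonIdx (Fin (d + 1)),
        |wm κ' (1 : Matrix Unit Unit ℝ) i a b| :=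
    Finset.single_le_sum (f := fun a : Unit × Fin (d + 1) => ∑ b : Unit × Fin (d + 1), ∑ i : WilsonIdx (Fin (d + 1)),
      |wm κ' (1 : Matrix Unit Unit ℝ) i a b|)
      (fun _ _ => Finset.sum_nonneg fun _ _ => Finset.sum_nonneg fun _ _ => abs_nonneg _) (Finset.mem_univ ((), α))
  have hγ : (∑ a : Unit × Fin (d + 1), ∑ b : Unit × Fin (d + 1), ∑ i : WilsonIdx (Fin (d + 1)),
        |wm κ' (1 : Matrix Unit Unit ℝ) i a b|) ≤ wBound d :=
    Finset.single_le_sum (f := fun γ : Fin (d + 1) => ∑ a : Unit × Fin (d + 1), ∑ b : Unit × Fin (d + 1),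
      ∑ i : WilsonIdx (Fin (d + 1)), |wm γ (1 : Matrix Unit Unit ℝ) i a b|)
      (fun _ _ => Finset.sum_nonneg fun _ _ => Finset.sum_nonneg fun _ _ => Finset.sum_nonneg fun _ _ => abs_nonneg _)
      (Finset.mem_univ κ')
  exact hb.trans (ha.trans hγ)

/-- `|e_μ|₁ = 1`. [folklore] -/
theorem l1_unitVec (μ : Fin (d + 1)) : l1 (unitVec μ : Fin (d + 1) → ℤ) = 1 := by
  unfold B12Sec2to5.l1
  simp only [unitVec_apply]
  rw [Finset.sum_eq_single μ (fun i _ hi => by simp [hi]) (fun h => absurd (Finset.mem_univ μ) h)]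
  simp

/-- `|x + y|₁ ≤ |x|₁ + |y|₁`. [folklore] -/
theorem l1_add_le (x y : Fin (d + 1) → ℤ) : l1 (x + y) ≤ l1 x + l1 y := by
  unfold B12Sec2to5.l1
  rw [← Finset.sum_add_distrib]
  refine Finset.sum_le_sum fun i _ => ?_
  simp only [Pi.add_apply, Int.cast_add]
  exact abs_add_le _ _

/-- **THE OFFSET ALPHABET LIES IN THE `ℓ¹`-BALL OF RADIUS 2**. [folklore] -/
theorem l1_isOffset_le {γ : Fin (d + 1)} {x : Fin (d + 1) → ℤ} (h : IsOffset (unitVec : Fin (d + 1) → (Fin (d + 1) → ℤ)) γ x) :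
    l1 x ≤ 2 := by
  rcases h with h | h | ⟨μ, h | h | h⟩
  · subst h
    unfold B12Sec2to5.l1
    simp
  · subst h; rw [l1_unitVec]; norm_num
  · subst h; rw [l1_unitVec]; norm_num
  · subst h; rw [l1_neg_eq, l1_unitVec]; norm_num
  · subst h
    rw [sub_eq_add_neg]
    refine (l1_add_le _ _).trans ?_
    rw [l1_neg_eq, l1_unitVec, l1_unitVec]
    norm_num

/-- FINITE RANGE: an entry vanishes unless both sites lie within `ℓ¹`-distance 2 of the background bond's site. [folklore] -/
theorem wEntry_eq_zero_or (κ' : Fin (d + 1)) (u x z : Fin (d + 1) → ℤ) (α β : Fin (d + 1)) :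
    wEntry d κ' u x z α β = 0 ∨ (l1 (x - u) ≤ 2 ∧ l1 (z - u) ≤ 2) := by
  by_cases h : wEntry d κ' u x z α β = 0
  · exact Or.inl h
  · right
    obtain ⟨⟨x₀, hx₀, hx⟩, ⟨z₀, hz₀, hz⟩⟩ := wilsonVertex₁_apply_ne_zero (C := Unit) unitVec u κ' (1 : Matrix Unit Unit ℝ) h
    dsimp only at hx hz
    rw [hx, hz, add_sub_cancel_left, add_sub_cancel_left]
    exact ⟨l1_isOffset_le hx₀, l1_isOffset_le hz₀⟩

/-- ENTRY BOUND IN `LocStencil` SHAPE for any rate `δ ≥ 0` (finite range ⇒ the factor `e^{4δ}`). [folklore] -/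
theorem abs_wEntry_le_exp {δ : ℝ} (hδ : 0 ≤ δ) (κ' : Fin (d + 1)) (u x z : Fin (d + 1) → ℤ) (α β : Fin (d + 1)) :
    |wEntry d κ' u x z α β| ≤ wBound d * Real.exp (4 * δ) * Real.exp (-δ * (l1 (x - u) + l1 (z - u))) := by
  rcases wEntry_eq_zero_or κ' u x z α β with h | ⟨hx, hz⟩
  · rw [h, abs_zero]
    exact mul_nonneg (mul_nonneg (wBound_nonneg d) (Real.exp_pos _).le) (Real.exp_pos _).le
  · have h1 : 1 ≤ Real.exp (4 * δ) * Real.exp (-δ * (l1 (x - u) + l1 (z - u))) := by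
      rw [← Real.exp_add]
      exact Real.one_le_exp (by nlinarith [mul_nonneg hδ (sub_nonneg.2 hx), mul_nonneg hδ (sub_nonneg.2 hz)])
    calc |wEntry d κ' u x z α β| ≤ wBound d * 1 := by rw [mul_one]; exact abs_wEntry_le κ' u x z α β
      _ ≤ wBound d * (Real.exp (4 * δ) * Real.exp (-δ * (l1 (x - u) + l1 (z - u)))) :=
          mul_le_mul_of_nonneg_left h1 (wBound_nonneg d)
      _ = _ := by ring

/-- **THE (V-Δ) FIELD-BLOCK STENCIL IS A LOCAL STENCIL FAMILY** for every rate `δ ≥ 0`, constant `wBound d · e^{4δ}`. [folklore] -/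
theorem locStencil_wilsonS {δ : ℝ} (hδ : 0 ≤ δ) : LocStencil (wilsonS d) (wBound d * Real.exp (4 * δ)) δ := by
  intro κ' u x z a b
  have h0 : |(0 : ℝ)| ≤ wBound d * Real.exp (4 * δ) * Real.exp (-δ * (l1 (x - u) + l1 (z - u))) := by
    rw [abs_zero]
    exact mul_nonneg (mul_nonneg (wBound_nonneg d) (Real.exp_pos _).le) (Real.exp_pos _).le
  rcases a with α | α <;> rcases b with β | β
  · show |1 / 2 * (wEntry d κ' u x z α β + wEntry d κ' u z x β α)| ≤ _
    have h1 := abs_wEntry_le_exp hδ κ' u x z α β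
    have h2 := abs_wEntry_le_exp hδ κ' u z x β α
    rw [add_comm (l1 (z - u)) (l1 (x - u))] at h2
    rw [abs_mul, abs_of_pos (by norm_num : (0 : ℝ) < 1 / 2)]
    have h3 := abs_add_le (wEntry d κ' u x z α β) (wEntry d κ' u z x β α)
    linarith [h1, h2, h3]
  · exact h0
  · exact h0
  · exact h0

/-- Translating the background bond translates the entries. [folklore] -/
theorem wEntry_translate (κ' : Fin (d + 1)) (u v x z : Fin (d + 1) → ℤ) (α β : Fin (d + 1)) :
    wEntry d κ' (u + v) x z α β = wEntry d κ' u (x - v) (z - v) α β := by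
  unfold wEntry
  rw [wilsonVertex₁_translate]

/-- **FINE-TRANSLATION COVARIANCE OF THE STENCIL FAMILY** (the hypothesis `hS` of `OneStepKernelFamily.vertexOfK_translate`):
`wilsonS d κ′ (u + v) = shiftK (−v) (wilsonS d κ′ u)`. [folklore] -/
theorem wilsonS_translate (κ' : Fin (d + 1)) (u v : Fin (d + 1) → ℤ) : wilsonS d κ' (u + v) = shiftK (-v) (wilsonS d κ' u) := by
  funext x z a b
  show wilsonS d κ' (u + v) x z a b = wilsonS d κ' u (x + -v) (z + -v) a b
  rcases a with α | α <;> rcases b with β | β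
  · show 1 / 2 * (wEntry d κ' (u + v) x z α β + wEntry d κ' (u + v) z x β α) =
      1 / 2 * (wEntry d κ' u (x + -v) (z + -v) α β + wEntry d κ' u (z + -v) (x + -v) β α)
    rw [wEntry_translate, wEntry_translate, ← sub_eq_add_neg, ← sub_eq_add_neg]
  · rfl
  · rfl
  · rfl

/-- `wilsonS` IS SYMMETRIC under exchanging the two legs (by construction; see the ERRATUM at `wilsonS`). [folklore] -/
theorem wilsonS_symm (κ' : Fin (d + 1)) (u x z : Fin (d + 1) → ℤ) (a b : Fib d) :
    wilsonS d κ' u x z a b = wilsonS d κ' u z x b a := by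
  rcases a with α | α <;> rcases b with β | β
  · show 1 / 2 * (wEntry d κ' u x z α β + wEntry d κ' u z x β α) = 1 / 2 * (wEntry d κ' u z x β α + wEntry d κ' u x z α β)
    rw [add_comm]
  · rfl
  · rfl
  · rfl

end Wilson

/-! ## §5 THE STRIPPING CONVENTION (v1.1; ERRATUM to §4): a colourless stencil is the COEFFICIENT OF `ad(t_c)`, hence
ANTISYMMETRIC on the packed fibre — the (V-Δ) field block is the antisymmetrised table `wilsonA`; the block-sign adapter `mfNeg` -/

section Stripping

variable {d : ℕ}

/-- **THE (V-Δ) FIELD-BLOCK STENCIL, STRIPPED IN THE `ad(t_c)`-COEFFICIENT CONVENTION** `wilsonA d κ′ u`: on the field block the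
ANTISYMMETRISED colourless Wilson vertex entries `½·(w(x,α; z,β) − w(z,β; x,α))` (`w = wEntry`, an3's `wilsonVertex₁` at `C := Unit`,
`A := 1`), zero on every block touching a multiplier leg.  WHY ANTISYMMETRISED (ERRATUM to §4's `wilsonS`): an3's headline
`PlaquetteStencil.actionJet21_eq_wilsonVertex₁` reads the `B`-linear `W`-Hessian as the QUADRATIC form `v ⬝ᵥ (wilsonVertex₁ e u κ′ (adM Y)) v`,
whose blocks are `k(x,α; z,β) · (adM Y)_{ab}` (`dotProduct_pairIns_mulVec`) with `adM Y` ANTISYMMETRIC (`PlaquetteVertex.adM_antisymm`); a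
quadratic form sees only the symmetric part of its matrix, and `sym(k ⊗ A) = antisym(k) ⊗ A` for `Aᵀ = −A` — so the physical colourless
table is the antisymmetric part of `k = wEntry`, and the symmetric part (`wilsonS`) cancels.  A definition asserting nothing. [folklore] -/
def wilsonA (d : ℕ) (κ' : Fin (d + 1)) (u : Fin (d + 1) → ℤ) : ExpKernelCalculus.MKer (d + 1) (Fib d) :=
  fun x z a b =>
    match a, b with
    | Sum.inl α, Sum.inl β => (1 / 2) * (wEntry d κ' u x z α β - wEntry d κ' u z x β α)
    | Sum.inl _, Sum.inr _ => 0
    | Sum.inr _, Sum.inl _ => 0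
    | Sum.inr _, Sum.inr _ => 0

/-- **`wilsonA` IS A LOCAL STENCIL FAMILY** for every rate `δ ≥ 0`, constant `wBound d · e^{4δ}` (same bound as `wilsonS`). [folklore] -/
theorem locStencil_wilsonA {δ : ℝ} (hδ : 0 ≤ δ) : LocStencil (wilsonA d) (wBound d * Real.exp (4 * δ)) δ := by
  intro κ' u x z a b
  have h0 : |(0 : ℝ)| ≤ wBound d * Real.exp (4 * δ) * Real.exp (-δ * (l1 (x - u) + l1 (z - u))) := by
    rw [abs_zero]
    exact mul_nonneg (mul_nonneg (wBound_nonneg d) (Real.exp_pos _).le) (Real.exp_pos _).le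
  rcases a with α | α <;> rcases b with β | β
  · show |1 / 2 * (wEntry d κ' u x z α β - wEntry d κ' u z x β α)| ≤ _
    have h1 := abs_wEntry_le_exp hδ κ' u x z α β
    have h2 := abs_wEntry_le_exp hδ κ' u z x β α
    rw [add_comm (l1 (z - u)) (l1 (x - u))] at h2
    rw [abs_mul, abs_of_pos (by norm_num : (0 : ℝ) < 1 / 2)]
    have h3 := abs_sub (wEntry d κ' u x z α β) (wEntry d κ' u z x β α)
    linarith [h1, h2, h3]
  · exact h0
  · exact h0
  · exact h0

/-- **FINE-TRANSLATION COVARIANCE** of `wilsonA` (the hypothesis `hS` of `OneStepKernelFamily.vertexOfK_translate`):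
`wilsonA d κ′ (u + v) = shiftK (−v) (wilsonA d κ′ u)`. [folklore] -/
theorem wilsonA_translate (κ' : Fin (d + 1)) (u v : Fin (d + 1) → ℤ) : wilsonA d κ' (u + v) = shiftK (-v) (wilsonA d κ' u) := by
  funext x z a b
  show wilsonA d κ' (u + v) x z a b = wilsonA d κ' u (x + -v) (z + -v) a b
  rcases a with α | α <;> rcases b with β | β
  · show 1 / 2 * (wEntry d κ' (u + v) x z α β - wEntry d κ' (u + v) z x β α) =
      1 / 2 * (wEntry d κ' u (x + -v) (z + -v) α β - wEntry d κ' u (z + -v) (x + -v) β α)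
    rw [wEntry_translate, wEntry_translate, ← sub_eq_add_neg, ← sub_eq_add_neg]
  · rfl
  · rfl
  · rfl

/-- `wilsonA` IS ANTISYMMETRIC under exchanging the two legs (it is the coefficient of the antisymmetric colour insertion in a
symmetric operator). [folklore] -/
theorem wilsonA_antisymm (κ' : Fin (d + 1)) (u x z : Fin (d + 1) → ℤ) (a b : Fib d) :
    wilsonA d κ' u z x b a = -wilsonA d κ' u x z a b := by
  rcases a with α | α <;> rcases b with β | β
  · show 1 / 2 * (wEntry d κ' u z x β α - wEntry d κ' u x z α β) = -(1 / 2 * (wEntry d κ' u x z α β - wEntry d κ' u z x β α))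
    ring
  · show (0 : ℝ) = -0
    rw [neg_zero]
  · show (0 : ℝ) = -0
    rw [neg_zero]
  · show (0 : ℝ) = -0
    rw [neg_zero]

/-- THE TABLE SPLITS into its two parts on the field block: `wilsonS + wilsonA` there is the raw entry `wEntry`. [folklore] -/
theorem wilsonS_add_wilsonA_inl_inl (κ' : Fin (d + 1)) (u x z : Fin (d + 1) → ℤ) (α β : Fin (d + 1)) :
    wilsonS d κ' u x z (Sum.inl α) (Sum.inl β) + wilsonA d κ' u x z (Sum.inl α) (Sum.inl β) = wEntry d κ' u x z α β := by
  show 1 / 2 * (wEntry d κ' u x z α β + wEntry d κ' u z x β α) + 1 / 2 * (wEntry d κ' u x z α β - wEntry d κ' u z x β α) = _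
  ring

/-- **THE BLOCK-SIGN ADAPTER** `mfNeg K`: negate the `(inr, inl)` (multiplier-row, field-column) block of a kernel on the packed fibre and
keep the other three.  In the `ad(t_c)`-coefficient convention a bordered first-order stencil whose true `(λ, W)` block is
`m · (ad t_c)_{(colour of row),(colour of column)}` has colourless blocks `(inl, inr) = m` and `(inr, inl) = −mᵀ` (ANTISYMMETRIC placement);
`mfNeg` converts a symmetrically placed field–multiplier family (e.g. `AveragingHessianKernels.packVH`, `vhS`) into that convention.
A definition asserting nothing. [folklore] -/
def mfNeg (K : ExpKernelCalculus.MKer (d + 1) (Fib d)) : ExpKernelCalculus.MKer (d + 1) (Fib d) :=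
  fun x z a b =>
    match a, b with
    | Sum.inl α, Sum.inl β => K x z (Sum.inl α) (Sum.inl β)
    | Sum.inl α, Sum.inr μ => K x z (Sum.inl α) (Sum.inr μ)
    | Sum.inr μ, Sum.inl α => -K x z (Sum.inr μ) (Sum.inl α)
    | Sum.inr μ, Sum.inr ν => K x z (Sum.inr μ) (Sum.inr ν)

/-- The `(inl, inl)` block is kept. [folklore] -/
@[simp] theorem mfNeg_inl_inl (K : ExpKernelCalculus.MKer (d + 1) (Fib d)) (x z : Fin (d + 1) → ℤ) (α β : Fin (d + 1)) :
    mfNeg K x z (Sum.inl α) (Sum.inl β) = K x z (Sum.inl α) (Sum.inl β) := rfl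

/-- The `(inl, inr)` block is kept. [folklore] -/
@[simp] theorem mfNeg_inl_inr (K : ExpKernelCalculus.MKer (d + 1) (Fib d)) (x z : Fin (d + 1) → ℤ) (α μ : Fin (d + 1)) :
    mfNeg K x z (Sum.inl α) (Sum.inr μ) = K x z (Sum.inl α) (Sum.inr μ) := rfl

/-- The `(inr, inl)` block is negated. [folklore] -/
@[simp] theorem mfNeg_inr_inl (K : ExpKernelCalculus.MKer (d + 1) (Fib d)) (x z : Fin (d + 1) → ℤ) (μ α : Fin (d + 1)) :
    mfNeg K x z (Sum.inr μ) (Sum.inl α) = -K x z (Sum.inr μ) (Sum.inl α) := rfl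

/-- The `(inr, inr)` block is kept. [folklore] -/
@[simp] theorem mfNeg_inr_inr (K : ExpKernelCalculus.MKer (d + 1) (Fib d)) (x z : Fin (d + 1) → ℤ) (μ ν : Fin (d + 1)) :
    mfNeg K x z (Sum.inr μ) (Sum.inr ν) = K x z (Sum.inr μ) (Sum.inr ν) := rfl

/-- The adapter preserves absolute values entrywise. [folklore] -/
theorem abs_mfNeg (K : ExpKernelCalculus.MKer (d + 1) (Fib d)) (x z : Fin (d + 1) → ℤ) (a b : Fib d) :
    |mfNeg K x z a b| = |K x z a b| := by
  rcases a with α | μ <;> rcases b with β | ν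
  · rfl
  · rfl
  · exact abs_neg _
  · rfl

/-- The adapter is an involution. [folklore] -/
theorem mfNeg_mfNeg (K : ExpKernelCalculus.MKer (d + 1) (Fib d)) : mfNeg (mfNeg K) = K := by
  funext x z a b
  rcases a with α | μ <;> rcases b with β | ν
  · rfl
  · rfl
  · show -(-K x z (Sum.inr μ) (Sum.inl β)) = _
    rw [neg_neg]
  · rfl

/-- The adapter is additive. [folklore] -/
theorem mfNeg_add (K L : ExpKernelCalculus.MKer (d + 1) (Fib d)) : mfNeg (K + L) = mfNeg K + mfNeg L := by
  funext x z a b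
  rcases a with α | μ <;> rcases b with β | ν
  · rfl
  · rfl
  · show -(K x z (Sum.inr μ) (Sum.inl β) + L x z (Sum.inr μ) (Sum.inl β)) =
      -K x z (Sum.inr μ) (Sum.inl β) + -L x z (Sum.inr μ) (Sum.inl β)
    rw [neg_add]
  · rfl

/-- The adapter commutes with scalars. [folklore] -/
theorem mfNeg_smul (c : ℝ) (K : ExpKernelCalculus.MKer (d + 1) (Fib d)) : mfNeg (c • K) = c • mfNeg K := by
  funext x z a b
  rcases a with α | μ <;> rcases b with β | ν
  · rfl
  · rfl
  · show -(c * K x z (Sum.inr μ) (Sum.inl β)) = c * -K x z (Sum.inr μ) (Sum.inl β)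
    rw [mul_neg]
  · rfl

/-- The adapter commutes with simultaneous shifts. [folklore] -/
theorem mfNeg_shiftK (v : Fin (d + 1) → ℤ) (K : ExpKernelCalculus.MKer (d + 1) (Fib d)) : mfNeg (shiftK v K) = shiftK v (mfNeg K) := by
  funext x z a b
  rcases a with α | μ <;> rcases b with β | ν <;> rfl

/-- **BI-LOCALISATION IS PRESERVED** (the bound is on absolute values). [folklore] -/
theorem biLoc_mfNeg {K : ExpKernelCalculus.MKer (d + 1) (Fib d)} {p q : Fin (d + 1) → ℤ} {C δ : ℝ} (h : BiLoc K p q C δ) :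
    BiLoc (mfNeg K) p q C δ := by
  intro x z a b
  rw [abs_mfNeg]
  exact h x z a b

/-- **LOCAL STENCIL FAMILIES ARE PRESERVED** by the adapter applied bond by bond. [folklore] -/
theorem locStencil_mfNeg {S : Fin (d + 1) → (Fin (d + 1) → ℤ) → ExpKernelCalculus.MKer (d + 1) (Fib d)} {C δ : ℝ}
    (h : LocStencil S C δ) : LocStencil (fun κ' u => mfNeg (S κ' u)) C δ :=
  fun κ' u => biLoc_mfNeg (h κ' u)

/-- **SYMMETRIC FIELD–MULTIPLIER PLACEMENT BECOMES ANTISYMMETRIC**: if `K` is symmetric with vanishing field–field and multiplier–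
multiplier blocks (the shape of `AveragingHessianKernels.packVH`), then `mfNeg K` is antisymmetric. [folklore] -/
theorem mfNeg_antisymm {K : ExpKernelCalculus.MKer (d + 1) (Fib d)} (hK : ∀ x z a b, K x z a b = K z x b a)
    (hff : ∀ x z (α β : Fin (d + 1)), K x z (Sum.inl α) (Sum.inl β) = 0)
    (hmm : ∀ x z (μ ν : Fin (d + 1)), K x z (Sum.inr μ) (Sum.inr ν) = 0) (x z : Fin (d + 1) → ℤ) (a b : Fib d) :
    mfNeg K z x b a = -mfNeg K x z a b := by
  rcases a with α | μ <;> rcases b with β | ν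
  · show K z x (Sum.inl β) (Sum.inl α) = -K x z (Sum.inl α) (Sum.inl β)
    rw [hff, hff, neg_zero]
  · show -K z x (Sum.inr ν) (Sum.inl α) = -K x z (Sum.inl α) (Sum.inr ν)
    rw [hK]
  · show K z x (Sum.inl β) (Sum.inr μ) = -(-K x z (Sum.inr μ) (Sum.inl β))
    rw [neg_neg, hK]
  · show K z x (Sum.inr ν) (Sum.inr μ) = -K x z (Sum.inr μ) (Sum.inr ν)
    rw [hmm, hmm, neg_zero]

/-- **A SUM OF STENCIL FAMILIES IS A STENCIL FAMILY** (constants add; for the assembly of the blocks). [folklore] -/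
theorem locStencil_add {S S' : Fin (d + 1) → (Fin (d + 1) → ℤ) → ExpKernelCalculus.MKer (d + 1) (Fib d)} {C C' δ : ℝ}
    (h : LocStencil S C δ) (h' : LocStencil S' C' δ) : LocStencil (fun κ' u => S κ' u + S' κ' u) (C + C') δ :=
  fun κ' u => biLoc_add (h κ' u) (h' κ' u)

/-- **A RESCALED STENCIL FAMILY IS A STENCIL FAMILY** (a real colour weight on a block). [folklore] -/
theorem locStencil_smul {S : Fin (d + 1) → (Fin (d + 1) → ℤ) → ExpKernelCalculus.MKer (d + 1) (Fib d)} {C δ : ℝ} (c : ℝ)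
    (h : LocStencil S C δ) : LocStencil (fun κ' u => c • S κ' u) (|c| * C) δ :=
  fun κ' u => biLoc_smul (h κ' u) c

end Stripping

end Literature.MathematicalPhysics.QuantumFieldTheory.Balaban1983to89.Beta.StepJetData

end
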